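import Mathlib
import Literature.NumberTheory.Sieve.DispersionBoxScale
import Literature.NumberTheory.Sieve.DispersionBoxNumerics
import Literature.NumberTheory.Sieve.DivisorBound
import HarnessLib

/-!
# P2 `stub_pair_middle` — the per-box dispersion bound: the per-class analytic bound

STATUS (worker W13, 2026-08-17): complete (no sorries); lands as
`Summits/Parity/BatemanHorn/Theorems/PolynomialMobiusPolyMobiusTailStubPairMiddleBoxDispCore.lean`
(registered auxiliary stub `stub_pair_middle_boxdisp_core`); the registered stub `stub_pair_middle_boxdisp`
is deduced from it in `…StubPairMiddleBoxDisp.lean` (work file `work/stubs/middle2/BoxDispFinal.lean`).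
Literature inputs landed by this worker: `DispersionBoxTools`, `DispersionBoxNumerics`, `DispersionBoxScale`.

Auxiliary stub of the line `eta-free-multilinear-window` (crux `PolyMobiusTail`), supporting `stub_pair_middle`
(dispersion for the `k = 2` linear window) through `stub_pair_middle_boxdisp`: for the pair
`(q₀X + a₀, q₁X + a₁)`, after `d₀ = t·u` and the classes `(c_d, c_m)` modulo `Q = q₁t`, the bilinear form
`𝒯 = ∑_{d₁ ≡ c_d} μ(d₁) log d₁ ∑_u μ(tu) log(tu) ∑_y [u ∣ q₀ d₁ (c_m + Qy) + Δ']` is bounded by the four standard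
terms (dyadic `d₁`, Cauchy–Schwarz, Linnik's dispersion on each scale = `DispersionBox.scale_dispersion_le`,
the Möbius main term = `DispersionBox.moebius_mainTerm_le`, real-variable bookkeeping).
-/

open scoped BigOperators
open Finset

namespace Summit.Parity.BatemanHorn.Theorems.PolyMobiusTail.EtaFreeWindow

open Literature.NumberTheory.Sieve
open Literature.NumberTheory.Sieve.DispersionBox

set_option maxHeartbeats 400000 in -- buildfix (bf3-g26): 160k/180k FAIL, 200k PASS at accept time; line-neutral budget line
/-- **Auxiliary stub `stub_pair_middle_boxdisp_core`** (head of the helper file for `stub_pair_middle_boxdisp`,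
line `eta-free-multilinear-window`): for the pair `(q₀X + a₀, q₁X + a₁)` (`Δ' = q₁a₀ − q₀a₁ ≠ 0`), a divisor
`t` of `N₀ = |q₀||Δ'|q₁`, `Q = q₁t` and classes `c_d, c_m`, the bilinear form
`𝒯 = ∑_{d₁ ∈ I, d₁ ≡ c_d (Q)} μ(d₁) log d₁ ∑_{u} μ(tu) log(tu) ∑_{y} [u ∣ q₀ d₁ (c_m + Qy) + Δ']`
(`u` squarefree, coprime to `|q₀||Δ'|Q`, `tu ∈ (P, P'] ∩ (x^{σ₁}, x^{σ₂}]`; `c_m + Qy ∈ (M_b, M_b']`) satisfies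
`|𝒯| ≤ K [ (1+log x)⁴ (x/M_b')(M_b'−M_b+1)^{1/2} + (x/M_b')(M_b'−M_b+1)(1+log x)^{−A}
  + x^δ (x/M_b')^{1/2}(M_b'−M_b+1) + x^δ (x^{1+θ}/P')^{1/2} P'^{3/2} ]`
(dyadic `d₁`, Cauchy–Schwarz, `DispersionBox.scale_dispersion_le`, `DispersionBox.moebius_mainTerm_le`). -/
theorem stub_pair_middle_boxdisp_core :
    ∀ (q₀ a₀ q₁ a₁ : ℤ) (σ₁ σ₂ δ A : ℝ), 0 < q₀ → 0 < q₁ → q₁ * a₀ - q₀ * a₁ ≠ 0 →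
      0 < σ₁ → σ₁ < σ₂ → σ₂ ≤ 1 → 0 < δ →
      ∃ K : ℝ, 0 < K ∧ ∃ x₀ : ℕ, ∀ x : ℕ, x₀ ≤ x → ∀ (θ η : ℝ) (Xb P P' Mb Mb' : ℕ),
        (x : ℝ) ^ σ₁ / 2 ≤ P → P < P' → 2 * P' ≤ 3 * P → (P' : ℝ) ≤ 2 * (x : ℝ) ^ σ₂ →
        Mb < Mb' → Mb' ≤ Xb → P' ≤ Xb → (Xb : ℝ) ≤ (x : ℝ) ^ (2 : ℝ) →
        ∀ (t Q : ℕ), t ∈ Nat.divisors (q₀.natAbs * (q₁ * a₀ - q₀ * a₁).natAbs * q₁.toNat) →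
        (Q : ℤ) = q₁ * t → ∀ (cd cm : ℤ),
        |∑ d₁ ∈ (Finset.Icc 1 Xb).filter (fun d₁ : ℕ =>
            ((x : ℝ) ^ (1 - η) / P < (d₁ : ℝ) ∧ (d₁ : ℝ) ≤ (x : ℝ) ^ (1 + θ) / P' ∧
              (d₁ : ℝ) ≤ ((q₁ : ℝ) * x + a₁) / Mb') ∧ (d₁ : ℤ) ≡ cd [ZMOD Q]),
          ((ArithmeticFunction.moebius d₁ : ℝ) * Real.log d₁) *
            ∑ u ∈ (Finset.Ioc (max (P / t) ⌊(x : ℝ) ^ σ₁ / t⌋₊)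
                (min (P' / t) ⌊(x : ℝ) ^ σ₂ / t⌋₊)).filter (fun u : ℕ =>
                  Squarefree u ∧ Nat.Coprime u (q₀.natAbs * (q₁ * a₀ - q₀ * a₁).natAbs * Q)),
              ((ArithmeticFunction.moebius (t * u) : ℝ) * Real.log ((t * u : ℕ) : ℝ)) *
                ∑ y ∈ Finset.Ioc (((Mb : ℤ) - cm) / (Q : ℤ)) (((Mb' : ℤ) - cm) / (Q : ℤ)),
                  (if (u : ℤ) ∣ q₀ * (d₁ : ℤ) * (cm + (Q : ℤ) * y) + (q₁ * a₀ - q₀ * a₁)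
                    then (1 : ℝ) else 0)| ≤
        K * ((1 + Real.log x) ^ 4 * ((x : ℝ) / Mb') * ((Mb' : ℝ) - Mb + 1) ^ (1 / 2 : ℝ) +
             ((x : ℝ) / Mb') * ((Mb' : ℝ) - Mb + 1) / (1 + Real.log x) ^ A +
             (x : ℝ) ^ δ * ((x : ℝ) / Mb') ^ (1 / 2 : ℝ) * ((Mb' : ℝ) - Mb + 1) +
             (x : ℝ) ^ δ * ((x : ℝ) ^ (1 + θ) / P') ^ (1 / 2 : ℝ) * (P' : ℝ) ^ (3 / 2 : ℝ)) := by
  intro q₀ a₀ q₁ a₁ σ₁ σ₂ δ A hq₀ hq₁ hΔ0 hσ₁ hσ₁₂ hσ₂ hδ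
  set Δ : ℤ := q₁ * a₀ - q₀ * a₁ with hΔdef
  /- ## Step 0: constants -/
  set N₀ : ℕ := q₀.natAbs * Δ.natAbs * q₁.toNat with hN₀
  have hq₀N : 0 < q₀.natAbs := Int.natAbs_pos.mpr hq₀.ne'
  have hΔN : 0 < Δ.natAbs := Int.natAbs_pos.mpr hΔ0
  have hq₁N : 0 < q₁.toNat := by omega
  have hN₀pos : 0 < N₀ := by positivity
  have hN₀r : (1 : ℝ) ≤ N₀ := by exact_mod_cast hN₀pos
  obtain ⟨Ke, hKe, hL1⟩ := scale_dispersion_le q₀ Δ hq₀.ne' hΔ0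
  obtain ⟨Λm, hΛm1, hL2⟩ := moebius_mainTerm_le σ₁ A hσ₁ N₀ hN₀pos
  obtain ⟨Cτ, hCτ, hτ⟩ := exists_card_divisors_le_mul_rpow (ε := δ / 3) (by positivity)
  obtain ⟨Λ₃, hΛ₃, hdec3⟩ := mul_one_add_rpow_le_exp 1 5 (ε := δ / 3) (by positivity) zero_le_one
  set Q₀ : ℕ := q₁.toNat * N₀ with hQ₀
  have hq₁nat : (q₁.toNat : ℤ) = q₁ := Int.toNat_of_nonneg hq₁.le
  have hQ₀pos : 0 < Q₀ := by positivity
  have hQ₀r : (1 : ℝ) ≤ Q₀ := by exact_mod_cast hQ₀pos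
  set cq : ℝ := (q₁ : ℝ) + |(a₁ : ℝ)| with hcq
  have hq₁r : (1 : ℝ) ≤ q₁ := by have : (1 : ℤ) ≤ q₁ := hq₁; exact_mod_cast this
  have hcq1 : 1 ≤ cq := by have := abs_nonneg (a₁ : ℝ); rw [hcq]; linarith only [this, hq₁r]
  set cL : ℝ := 1 + Real.log N₀ with hcL
  set cℓ : ℝ := 3 + Real.log (2 * Q₀) with hcℓ
  have hlog2Q₀ : 0 ≤ Real.log (2 * Q₀) := Real.log_nonneg (by linarith only [hQ₀r])
  have hcℓ0 : 0 ≤ cℓ := by rw [hcℓ]; linarith only [hlog2Q₀]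
  set c1 : ℝ := 8 * cL ^ 2 with hc1
  set c2 : ℝ := 8 * Q₀ * cL ^ 2 with hc2
  set c3 : ℝ := 4 * Q₀ ^ 2 * cL ^ 2 * Ke * Cτ ^ 4 * cℓ ^ 3 with hc3
  set c4 : ℝ := cL ^ 2 * Ke * Cτ ^ 4 * cℓ ^ 3 with hc4
  have hc1_0 : 0 ≤ c1 := by positivity
  have hc2_0 : 0 ≤ c2 := by positivity
  have hc3_0 : 0 ≤ c3 := by positivity
  have hc4_0 : 0 ≤ c4 := by positivity
  set K : ℝ := 3 * cq * ((4 * c1 + 1) + (4 * c2 + 1) + (4 * c3 + 1) + (4 * c4 + 1)) with hK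
  have hKpos : 0 < K := by positivity
  refine ⟨K, hKpos, ?_⟩
  set Λ : ℝ := max (max Λm Λ₃) (Real.log (8 * N₀) / σ₁) with hΛ
  refine ⟨max (N₀ ^ 3) ⌈Real.exp Λ⌉₊, ?_⟩
  intro x hx θ η Xb P P' Mb Mb' hP hPP' hP'P hP'x hMb hMbX hP'X hXb t Q ht hQt cd cm
  /- ## Step 1: the size of `x` -/
  have hxN : N₀ ^ 3 ≤ x := le_trans (le_max_left _ _) hx
  have hxΛ' : ⌈Real.exp Λ⌉₊ ≤ x := le_trans (le_max_right _ _) hx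
  have hx1 : 1 ≤ x := le_trans (Nat.one_le_pow _ _ hN₀pos) hxN
  have hX1 : (1 : ℝ) ≤ x := by exact_mod_cast hx1
  have hX0 : (0 : ℝ) < x := by linarith only [hX1]
  have hxN' : ((N₀ : ℝ)) ^ 3 ≤ x := by exact_mod_cast hxN
  set Lx : ℝ := Real.log x with hLx
  have hLx0 : 0 ≤ Lx := Real.log_nonneg hX1
  have hLxΛ : Λ ≤ Lx := by
    have h1 : Real.exp Λ ≤ x := le_trans (Nat.le_ceil _) (by exact_mod_cast hxΛ')
    have := Real.log_le_log (Real.exp_pos _) h1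
    rwa [Real.log_exp] at this
  have hΛall := hLxΛ
  simp only [hΛ, max_le_iff] at hΛall
  obtain ⟨⟨hΛmL, hΛ₃L⟩, hΛ₆L⟩ := hΛall
  set L₀ : ℝ := 1 + Lx with hL₀
  have hL₀1 : 1 ≤ L₀ := by rw [hL₀]; linarith only [hLx0]
  have hL₀pos : 0 < L₀ := by linarith only [hL₀1]
  have hxσ : (8 * N₀ : ℝ) ≤ (x : ℝ) ^ σ₁ := by
    have h1 : Real.log (8 * N₀) ≤ σ₁ * Lx := by rwa [div_le_iff₀' hσ₁] at hΛ₆L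
    calc (8 * N₀ : ℝ) = Real.exp (Real.log (8 * N₀)) := (Real.exp_log (by positivity)).symm
      _ ≤ Real.exp (Real.log x * σ₁) := Real.exp_le_exp.mpr (by
          rw [hLx] at h1; linarith only [h1, mul_comm (Real.log (x : ℝ)) σ₁])
      _ = (x : ℝ) ^ σ₁ := (Real.rpow_def_of_pos hX0 σ₁).symm
  /- ## Step 2: `t`, `Q`, `G` -/
  have htpos : 0 < t := Nat.pos_of_mem_divisors ht
  have htN : t ≤ N₀ := Nat.divisor_le ht
  have htr : (1 : ℝ) ≤ t := by exact_mod_cast htpos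
  have htNr : (t : ℝ) ≤ N₀ := by exact_mod_cast htN
  have hQz : (0 : ℤ) < Q := by rw [hQt]; positivity
  have hQpos : 0 < Q := by exact_mod_cast hQz
  have hQQ₀ : Q ≤ Q₀ := by
    have : (Q : ℤ) ≤ (Q₀ : ℤ) := by
      rw [hQt, hQ₀]; push_cast; rw [hq₁nat]
      exact mul_le_mul_of_nonneg_left (by exact_mod_cast htN) hq₁.le
    exact_mod_cast this
  have hQr1 : (1 : ℝ) ≤ Q := by exact_mod_cast hQpos
  have hQQ₀r : (Q : ℝ) ≤ Q₀ := by exact_mod_cast hQQ₀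
  set G : ℕ := q₀.natAbs * Δ.natAbs * Q with hG
  have hGpos : 0 < G := by positivity
  have hGle : G ≤ N₀ * N₀ := by
    calc G ≤ q₀.natAbs * Δ.natAbs * Q₀ := Nat.mul_le_mul_left _ hQQ₀
      _ = N₀ * N₀ := by rw [hQ₀, hN₀]; ring
  have hGr : (G : ℝ) ≤ (N₀ : ℝ) * N₀ := by exact_mod_cast hGle
  set U₁ : ℕ := max (P / t) ⌊(x : ℝ) ^ σ₁ / t⌋₊ with hU₁
  set U₂ : ℕ := min (P' / t) ⌊(x : ℝ) ^ σ₂ / t⌋₊ with hU₂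
  set U : Finset ℕ := (Finset.Ioc U₁ U₂).filter (fun u : ℕ => Squarefree u ∧ Nat.Coprime u G)
    with hUdef
  set y₁ : ℤ := ((Mb : ℤ) - cm) / (Q : ℤ) with hy₁
  set y₂ : ℤ := ((Mb' : ℤ) - cm) / (Q : ℤ) with hy₂
  set D : Finset ℕ := (Finset.Icc 1 Xb).filter (fun d₁ : ℕ =>
    ((x : ℝ) ^ (1 - η) / P < (d₁ : ℝ) ∧ (d₁ : ℝ) ≤ (x : ℝ) ^ (1 + θ) / P' ∧
      (d₁ : ℝ) ≤ ((q₁ : ℝ) * x + a₁) / Mb') ∧ (d₁ : ℤ) ≡ cd [ZMOD Q]) with hD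
  set W : ℝ := (Mb' : ℝ) - Mb + 1 with hWdef
  set w : ℕ → ℝ := fun n => (ArithmeticFunction.moebius n : ℝ) * Real.log n with hw
  set S : ℕ → ℝ := fun d => ∑ u ∈ U, ((ArithmeticFunction.moebius (t * u) : ℝ) * Real.log ((t * u : ℕ) : ℝ)) *
    ∑ y ∈ Finset.Ioc y₁ y₂, (if (u : ℤ) ∣ q₀ * (d : ℤ) * (cm + (Q : ℤ) * y) + Δ then (1 : ℝ) else 0)
    with hS
  show |∑ d₁ ∈ D, w d₁ * S d₁| ≤ _
  /- ## Step 4: elementary facts -/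
  have hw_abs : ∀ n : ℕ, |w n| ≤ Real.log n := fun n => by
    have h1 : |(ArithmeticFunction.moebius n : ℝ)| ≤ 1 := by
      exact_mod_cast ArithmeticFunction.abs_moebius_le_one
    have h2 : 0 ≤ Real.log (n : ℝ) := Real.log_natCast_nonneg n
    simp only [hw, abs_mul, abs_of_nonneg h2]
    exact (mul_le_mul_of_nonneg_right h1 h2).trans (one_mul _).le
  have hMb'pos : 0 < Mb' := by omega
  have hMb'r : (0 : ℝ) < Mb' := by exact_mod_cast hMb'pos
  have hXb0 : 0 < Xb := by omega
  have hXbr : (0 : ℝ) < Xb := by exact_mod_cast hXb0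
  have hMbMb' : (Mb : ℝ) + 1 ≤ Mb' := by exact_mod_cast hMb
  have hMb0 : (0 : ℝ) ≤ Mb := Nat.cast_nonneg _
  have hW1 : 1 ≤ W := by rw [hWdef]; linarith only [hMbMb', hMb0]
  have hW0 : 0 ≤ W := by linarith only [hW1]
  have hx2 : (1 : ℝ) ≤ (x : ℝ) ^ 2 := one_le_pow₀ hX1
  have hXbx2 : (Xb : ℝ) ≤ (x : ℝ) ^ 2 := by rw [← Real.rpow_natCast]; exact_mod_cast hXb
  have hWx : W ≤ 2 * (x : ℝ) ^ 2 := by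
    have h1 : (Mb' : ℝ) ≤ Xb := by exact_mod_cast hMbX
    rw [hWdef]; linarith only [h1, hXbx2, hMb0, hx2]
  have hlogXb : Real.log Xb ≤ 2 * Lx := by
    have := Real.log_le_log hXbr hXb
    rwa [Real.log_rpow hX0] at this
  have hP'pos : 0 < P' := by omega
  have hP'r : (1 : ℝ) ≤ P' := by exact_mod_cast hP'pos
  have hP'0 : (0 : ℝ) < P' := by linarith only [hP'r]
  have hxσ₂ : (x : ℝ) ^ σ₂ ≤ x := by
    calc (x : ℝ) ^ σ₂ ≤ (x : ℝ) ^ (1 : ℝ) := Real.rpow_le_rpow_of_exponent_le hX1 hσ₂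
      _ = x := Real.rpow_one _
  /- ## Step 5: `ξ = x^{δ/3}`, the decay factor, the scale-independent quantities; the case `U = ∅` -/
  set ξ : ℝ := (x : ℝ) ^ (δ / 3) with hξ
  have hξ1 : 1 ≤ ξ := Real.one_le_rpow hX1 (by positivity)
  have hξ3 : ξ ^ 3 = (x : ℝ) ^ δ := by
    rw [hξ, ← Real.rpow_natCast, ← Real.rpow_mul hX0.le]; norm_num
  have hL₀ξ : (1 + Lx) ^ 5 ≤ ξ := by
    have h := hdec3 Lx hΛ₃L
    rw [one_mul] at h
    calc (1 + Lx) ^ 5 = (1 + Lx) ^ (5 : ℝ) := by exact_mod_cast (Real.rpow_natCast _ 5).symm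
      _ ≤ Real.exp (δ / 3 * Lx) := h
      _ = ξ := by rw [hξ, Real.rpow_def_of_pos hX0, ← hLx]; ring_nf
  set dec : ℝ := (1 + Lx) ^ (-(2 * A + 8)) with hdecdef
  have hdec0 : 0 ≤ dec := Real.rpow_nonneg hL₀pos.le _
  set ρ₁ : ℝ := cq * x / Mb' with hρ₁
  set ρ₂ : ℝ := (x : ℝ) ^ (1 + θ) / P' with hρ₂
  set Zs : ℝ := (4 * c1 + 1) * L₀ ^ 3 * ρ₁ * Real.sqrt W + (4 * c2 + 1) * L₀ ^ 3 * ρ₁ * W * Real.sqrt dec +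
    (4 * c3 + 1) * L₀ ^ 4 * ξ ^ 2 * Real.sqrt ρ₁ * W +
    (4 * c4 + 1) * L₀ ^ 4 * ξ ^ 2 * Real.sqrt ρ₂ * P' * Real.sqrt P' with hZs
  have hZs0 : 0 ≤ Zs := by positivity
  have hfin : 3 * L₀ * Zs ≤ K * ((1 + Lx) ^ 4 * ((x : ℝ) / Mb') * W ^ (1 / 2 : ℝ) +
      ((x : ℝ) / Mb') * W / (1 + Lx) ^ A + (x : ℝ) ^ δ * ((x : ℝ) / Mb') ^ (1 / 2 : ℝ) * W +
      (x : ℝ) ^ δ * ((x : ℝ) ^ (1 + θ) / P') ^ (1 / 2 : ℝ) * (P' : ℝ) ^ (3 / 2 : ℝ)) := by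
    have h := final_collect (M := (Mb' : ℝ)) (W := W) (P := (P' : ℝ)) (A := A) (θ := θ)
      hLx0 hX0 hMb'r hW0 hP'0 hcq1 hc1_0 hc2_0 hc3_0 hc4_0 hL₀ξ hξ3 hdecdef
    rw [hZs, hL₀, hρ₁, hρ₂, hK]
    exact h
  rcases Finset.eq_empty_or_nonempty U with hUe | hUne
  · have hS0 : ∀ d, S d = 0 := fun d => by simp only [hS, hUe, Finset.sum_empty]
    simp only [hS0, mul_zero, Finset.sum_const_zero, abs_zero]
    exact le_trans (by positivity) hfin
  /- ## Step 6: `U ≠ ∅`: sizes of `U₁, U₂` -/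
  have hmemU : ∀ u ∈ U, U₁ < u ∧ u ≤ U₂ ∧ Squarefree u ∧ Nat.Coprime u G := fun u hu => by
    simp only [hUdef, Finset.mem_filter, Finset.mem_Ioc] at hu
    exact ⟨hu.1.1, hu.1.2, hu.2.1, hu.2.2⟩
  obtain ⟨u₀, hu₀⟩ := hUne
  have hU₁₂ : U₁ < U₂ := lt_of_lt_of_le (hmemU u₀ hu₀).1 (hmemU u₀ hu₀).2.1
  have hP4t : 4 * t ≤ P := by
    have : (4 * t : ℝ) ≤ P := by linarith only [hxσ, hP, htNr]
    exact_mod_cast this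
  have hU₁P : P / t ≤ U₁ := le_max_left _ _
  have h4U₁ : 4 ≤ U₁ := le_trans ((Nat.le_div_iff_mul_le htpos).mpr hP4t) hU₁P
  have h1U₁ : 1 ≤ U₁ := le_trans (by norm_num) h4U₁
  have hU₂P' : U₂ ≤ P' / t := min_le_left _ _
  have hU₂x' : U₂ ≤ ⌊(x : ℝ) ^ σ₂ / t⌋₊ := min_le_right _ _
  have hU₁r : (1 : ℝ) ≤ U₁ := by exact_mod_cast h1U₁
  have hU₁U₂r : (U₁ : ℝ) ≤ U₂ := by exact_mod_cast hU₁₂.le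
  have hU₂x : (U₂ : ℝ) ≤ x := by
    have h1 : (U₂ : ℝ) ≤ ⌊(x : ℝ) ^ σ₂ / t⌋₊ := by exact_mod_cast hU₂x'
    have h2 : (⌊(x : ℝ) ^ σ₂ / t⌋₊ : ℝ) ≤ (x : ℝ) ^ σ₂ / t := Nat.floor_le (by positivity)
    have h3 : (x : ℝ) ^ σ₂ / t ≤ (x : ℝ) ^ σ₂ := div_le_self (by positivity) htr
    linarith only [h1, h2, h3, hxσ₂]
  have hU₁x : (U₁ : ℝ) ≤ x := hU₁U₂r.trans hU₂x
  have hU₂P'r : (U₂ : ℝ) ≤ P' := by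
    have h1 : (U₂ : ℝ) ≤ ((P' / t : ℕ) : ℝ) := by exact_mod_cast hU₂P'
    exact h1.trans (Nat.cast_div_le.trans (div_le_self (by positivity) htr))
  have hU₁P'r : (U₁ : ℝ) ≤ P' := hU₁U₂r.trans hU₂P'r
  have hU₂2U₁ : U₂ ≤ 2 * U₁ := by
    have h1r : (U₂ : ℝ) * t ≤ P' := by exact_mod_cast (Nat.le_div_iff_mul_le htpos).mp hU₂P'
    have h2r : (P : ℝ) < (P / t : ℕ) * t + t := by exact_mod_cast Nat.lt_div_mul_add htpos
    have h3r : ((P / t : ℕ) : ℝ) ≤ U₁ := by exact_mod_cast hU₁P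
    have h4r : (2 * P' : ℝ) ≤ 3 * P := by exact_mod_cast hP'P
    have h5r : (4 * t : ℝ) ≤ P := by exact_mod_cast hP4t
    have htr0 : (0 : ℝ) < t := by linarith only [htr]
    have h7 := mul_le_mul_of_nonneg_right h3r htr0.le
    have key : ¬ 2 * (U₁ : ℝ) < U₂ := fun hc => by
      linarith only [h1r, h2r, h7, h4r, h5r, mul_lt_mul_of_pos_right hc htr0]
    exact_mod_cast le_of_not_gt key
  have hVU₁ : (x : ℝ) ^ σ₁ / (2 * N₀) ≤ U₁ := by
    have h2 : (⌊(x : ℝ) ^ σ₁ / t⌋₊ : ℝ) ≤ U₁ := by exact_mod_cast (le_max_right _ _ : _ ≤ U₁)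
    have h3 : (x : ℝ) ^ σ₁ / t - 1 < ⌊(x : ℝ) ^ σ₁ / t⌋₊ := by
      have := Nat.lt_floor_add_one ((x : ℝ) ^ σ₁ / t); linarith only [this]
    have h4 : (x : ℝ) ^ σ₁ / N₀ ≤ (x : ℝ) ^ σ₁ / t :=
      div_le_div_of_nonneg_left (by positivity) (by positivity) htNr
    have hN : (0 : ℝ) < N₀ := by positivity
    rw [div_le_iff₀ (by positivity)]
    have h5 : (x : ℝ) ^ σ₁ / N₀ - 1 < U₁ := by linarith only [h2, h3, h4]
    have h6 : (x : ℝ) ^ σ₁ - N₀ < U₁ * N₀ := by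
      have := mul_lt_mul_of_pos_right h5 hN
      rwa [sub_mul, one_mul, div_mul_cancel₀ _ hN.ne'] at this
    linarith only [h6, hxσ]
  /- ## Step 7: `L_t`, the `y`-range, `ξ = x^{δ/3}` -/
  have hU₂pos : 0 < U₂ := by omega
  set Lt : ℝ := 1 + Real.log ((t : ℝ) * U₂) with hLt
  have htU₂ : (1 : ℝ) ≤ (t : ℝ) * U₂ :=
    one_le_mul_of_one_le_of_one_le htr (by exact_mod_cast hU₂pos)
  have hLt1 : 1 ≤ Lt := by have := Real.log_nonneg htU₂; rw [hLt]; linarith only [this]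
  have hLt0 : 0 < Lt := by linarith only [hLt1]
  have hLtle : Lt ≤ cL * L₀ := by
    have h1 : Real.log ((t : ℝ) * U₂) ≤ Real.log N₀ + Lx := by
      rw [← Real.log_mul (by positivity) (by positivity)]
      exact Real.log_le_log (by positivity) (mul_le_mul htNr hU₂x (by positivity) (by positivity))
    have h2 : 0 ≤ Real.log (N₀ : ℝ) := Real.log_nonneg hN₀r
    have h3 := mul_nonneg h2 hLx0
    have e : cL * L₀ = 1 + Lx + Real.log N₀ + Real.log N₀ * Lx := by rw [hcL, hL₀]; ring
    rw [hLt, e]; linarith only [h1, h3]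
  have hy12 : y₁ ≤ y₂ := Int.ediv_le_ediv (by exact_mod_cast hQpos) (by
    have : (Mb : ℤ) ≤ Mb' := by exact_mod_cast hMb.le
    linarith only [this])
  have hY0 : (0 : ℝ) ≤ ((y₂ - y₁ : ℤ) : ℝ) := by exact_mod_cast sub_nonneg.mpr hy12
  have hYW : ((y₂ - y₁ : ℤ) : ℝ) ≤ W := by
    have h1 := cast_ediv_sub_ediv_le hQpos cm hMb.le
    have h2 : ((Mb' : ℝ) - Mb) / Q ≤ (Mb' : ℝ) - Mb := div_le_self (by linarith only [hMbMb']) hQr1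
    rw [hWdef]; linarith only [h1, h2]
  have hmrange : ∀ y ∈ Finset.Ioc y₁ y₂, 0 < cm + Q * y ∧ ((cm + Q * y : ℤ) : ℝ) ≤ (x : ℝ) ^ 2 := by
    intro y hy
    obtain ⟨h1, h2⟩ := lt_and_le_of_mem_Ioc_ediv hQpos hy
    refine ⟨by omega, ?_⟩
    have h3 : ((cm + Q * y : ℤ) : ℝ) ≤ ((Mb' : ℤ) : ℝ) := by exact_mod_cast h2
    have h4 : (Mb' : ℝ) ≤ Xb := by exact_mod_cast hMbX
    push_cast at h3 ⊢
    linarith only [h3, h4, hXbx2]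
  have hT1 : 1 ≤ Cτ * ξ := one_le_mul_of_one_le_of_one_le hCτ hξ1
  have hτu : ∀ u ∈ U, ((Nat.divisors u).card : ℝ) ≤ Cτ * ξ := fun u hu => by
    have hu1 : u ≠ 0 := by have := (hmemU u hu).1; omega
    have hux : (u : ℝ) ≤ x := le_trans (by exact_mod_cast (hmemU u hu).2.1) hU₂x
    calc ((Nat.divisors u).card : ℝ) ≤ Cτ * (u : ℝ) ^ (δ / 3) := hτ u hu1
      _ ≤ Cτ * ξ := mul_le_mul_of_nonneg_left
          (Real.rpow_le_rpow (Nat.cast_nonneg _) hux (by positivity)) (by linarith only [hCτ])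
  have hMTb := hL2 (x : ℝ) t G U₁ U₂ Q cm y₁ y₂ W Q₀ hΛmL hX1 htpos htNr hGpos hGr hxN' h1U₁ hU₁₂.le
    hU₂2U₁ hU₂x hVU₁ hQpos hQQ₀r hy12 hYW hW1 hWx hmrange
  have hDsub : ∀ d ∈ D, (1 ≤ d ∧ d ≤ Xb) ∧ ((d : ℝ) ≤ (x : ℝ) ^ (1 + θ) / P' ∧
      (d : ℝ) ≤ ((q₁ : ℝ) * x + a₁) / Mb') ∧ (d : ℤ) ≡ cd [ZMOD Q] := fun d hd => by
    simp only [hD, Finset.mem_filter, Finset.mem_Icc] at hd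
    exact ⟨hd.1, ⟨hd.2.1.2.1, hd.2.1.2.2⟩, hd.2.2⟩
  have hqxa : ((q₁ : ℝ) * x + a₁) / Mb' ≤ ρ₁ := by
    rw [hρ₁]; apply div_le_div_of_nonneg_right _ hMb'r.le
    have h1 := le_abs_self (a₁ : ℝ)
    have h2 : |(a₁ : ℝ)| ≤ |(a₁ : ℝ)| * x := le_mul_of_one_le_right (abs_nonneg _) hX1
    rw [hcq, add_mul]; linarith only [h1, h2]
  /- ## Step 10: one dyadic scale -/
  have perk : ∀ k : ℕ, |∑ d ∈ D.filter (fun d => Nat.log 2 d = k), w d * S d| ≤ Zs := by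
    intro k
    set Dk : Finset ℕ := D.filter (fun d => Nat.log 2 d = k) with hDk
    rcases Dk.eq_empty_or_nonempty with hDke | ⟨d₀, hd₀⟩
    · rw [hDke, Finset.sum_empty, abs_zero]; exact hZs0
    set R : ℝ := (2 : ℝ) ^ k with hR
    have hR1 : 1 ≤ R := one_le_pow₀ (by norm_num)
    have hR0 : 0 < R := by linarith only [hR1]
    have hmemDk : ∀ d ∈ Dk, d ∈ D ∧ (R ≤ d ∧ (d : ℝ) < 2 * R) := fun d hd => by
      rw [hDk, Finset.mem_filter] at hd
      have hd1 : d ≠ 0 := by have := (hDsub d hd.1).1.1; omega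
      obtain ⟨h1, h2⟩ := pow_le_and_lt_of_natLog_eq hd1 hd.2
      refine ⟨hd.1, ?_, ?_⟩
      · rw [hR]; exact_mod_cast h1
      · rw [hR]; have : ((d : ℕ) : ℝ) < ((2 ^ (k + 1) : ℕ) : ℝ) := by exact_mod_cast h2
        rw [pow_succ] at this; push_cast at this; linarith only [this]
    have hDkhyp : ∀ d ∈ Dk, R ≤ (d : ℝ) ∧ (d : ℝ) < 2 * R ∧ (d : ℤ) ≡ cd [ZMOD Q] := fun d hd =>
      ⟨(hmemDk d hd).2.1, (hmemDk d hd).2.2, (hDsub d (hmemDk d hd).1).2.2⟩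
    obtain ⟨hd₀D, hRd₀, -⟩ := hmemDk d₀ hd₀
    have hRρ₁ : R ≤ ρ₁ := hRd₀.trans ((hDsub d₀ hd₀D).2.1.2.trans hqxa)
    have hRρ₂ : R ≤ ρ₂ := hRd₀.trans (hDsub d₀ hd₀D).2.1.1
    have hRx2 : R ≤ (x : ℝ) ^ 2 := (hRd₀.trans (by exact_mod_cast (hDsub d₀ hd₀D).1.2)).trans hXbx2
    have hCS : |∑ d ∈ Dk, w d * S d| ≤
        Real.sqrt (∑ d ∈ Dk, w d ^ 2) * Real.sqrt (∑ d ∈ Dk, S d ^ 2) := by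
      rw [← Real.sqrt_mul (Finset.sum_nonneg fun i _ => sq_nonneg _)]
      exact Real.abs_le_sqrt (Finset.sum_mul_sq_le_sq_mul_sq Dk w S)
    have hw2 : ∑ d ∈ Dk, w d ^ 2 ≤ 4 * L₀ ^ 2 * R := by
      have h1 : ∀ d ∈ Dk, w d ^ 2 ≤ (2 * L₀) ^ 2 := fun d hd => by
        have hdD := (hmemDk d hd).1
        have hd1 : (1 : ℝ) ≤ d := by exact_mod_cast (hDsub d hdD).1.1
        have hdX : (d : ℝ) ≤ Xb := by exact_mod_cast (hDsub d hdD).1.2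
        have hwd : |w d| ≤ 2 * L₀ := by
          calc |w d| ≤ Real.log d := hw_abs d
            _ ≤ Real.log Xb := Real.log_le_log (by linarith only [hd1]) hdX
            _ ≤ 2 * L₀ := by rw [hL₀]; linarith only [hlogXb, hLx0]
        exact sq_le_sq' (by linarith only [(abs_le.mp hwd).1, hL₀1]) (abs_le.mp hwd).2
      have hcard : (Dk.card : ℝ) ≤ R := by
        have hsub : Dk ⊆ Finset.Ico (2 ^ k) (2 ^ (k + 1)) := fun d hd => by
          rw [hDk, Finset.mem_filter] at hd
          have hd1 : d ≠ 0 := by have := (hDsub d hd.1).1.1; omega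
          exact Finset.mem_Ico.mpr (pow_le_and_lt_of_natLog_eq hd1 hd.2)
        have := Finset.card_le_card hsub
        rw [Nat.card_Ico, pow_succ, show 2 ^ k * 2 - 2 ^ k = 2 ^ k by omega] at this
        rw [hR]; exact_mod_cast this
      calc ∑ d ∈ Dk, w d ^ 2 ≤ ∑ d ∈ Dk, (2 * L₀) ^ 2 := Finset.sum_le_sum h1
        _ = Dk.card * (2 * L₀) ^ 2 := by rw [Finset.sum_const, nsmul_eq_mul]
        _ ≤ R * (2 * L₀) ^ 2 := mul_le_mul_of_nonneg_right hcard (sq_nonneg _)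
        _ = 4 * L₀ ^ 2 * R := by ring
    have hE1 := hL1 t Q U₁ U₂ cd cm y₁ y₂ (Cτ * ξ) R Dk htpos hQpos h1U₁ hU₁₂.le hU₂2U₁ hy12 hT1 hR1
      hτu hDkhyp
    have hErr := err_term_le (K := Ke) (Cτ := Cτ) (ξ := ξ) (Q₀ := (Q₀ : ℝ)) (P := (P' : ℝ))
      (Y := ((y₂ - y₁ : ℤ) : ℝ)) hKe.le hU₁r hU₁x hU₁P'r hQr1 hQQ₀r hR1 hRx2 hY0 hYW hW1 hX1
    have hS2 := scale_combine (cL := cL) (K := Ke) (Cτ := Cτ) (ξ := ξ) (cℓ := cℓ) (P := (P' : ℝ))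
      hE1 hMTb (by push_cast at hErr ⊢; exact hErr) (Finset.sum_nonneg fun i _ => sq_nonneg _)
      hLt0 hLtle hR0.le
    have hS2' : ∑ d ∈ Dk, S d ^ 2 ≤ c1 * L₀ ^ 3 * R * W + c2 * L₀ ^ 3 * R * W ^ 2 * dec +
        c3 * L₀ ^ 5 * ξ ^ 4 * W ^ 2 + c4 * L₀ ^ 5 * ξ ^ 4 * (P' : ℝ) ^ 3 := by
      rw [hc1, hc2, hc3, hc4, hdecdef, hL₀, hLx]; exact hS2
    have hnum := sqrt_mul_sqrt_le_four_terms (c1 := c1) (c2 := c2) (c3 := c3) (c4 := c4)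
      (P := (P' : ℝ)) hL₀1 hR0.le hW0 hdec0 hRρ₁ hRρ₂
      hP'0.le hc1_0 hc2_0 hc3_0 hc4_0 (Finset.sum_nonneg fun i _ => sq_nonneg _) hw2 hS2'
    rw [hZs]
    exact hCS.trans hnum
  have hDX : ∀ d ∈ D, d ≤ Xb := fun d hd => (hDsub d hd).1.2
  rw [sum_eq_sum_range_natLog D hDX]
  have hnk : ((Nat.log 2 Xb + 1 : ℕ) : ℝ) ≤ 3 * L₀ := by
    push_cast; rw [hL₀]; exact natLog_two_add_one_le (by omega) hX1 hXb
  have hsum : |∑ k ∈ Finset.range (Nat.log 2 Xb + 1), ∑ d ∈ D.filter (fun d => Nat.log 2 d = k),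
      w d * S d| ≤ 3 * L₀ * Zs := by
    calc _ ≤ ∑ k ∈ Finset.range (Nat.log 2 Xb + 1), |∑ d ∈ D.filter (fun d => Nat.log 2 d = k),
          w d * S d| := Finset.abs_sum_le_sum_abs _ _
      _ ≤ ∑ k ∈ Finset.range (Nat.log 2 Xb + 1), Zs := Finset.sum_le_sum fun k _ => perk k
      _ = ((Nat.log 2 Xb + 1 : ℕ) : ℝ) * Zs := by
          rw [Finset.sum_const, Finset.card_range, nsmul_eq_mul]
      _ ≤ 3 * L₀ * Zs := mul_le_mul_of_nonneg_right hnk hZs0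
  exact hsum.trans hfin


end Summit.Parity.BatemanHorn.Theorems.PolyMobiusTail.EtaFreeWindow
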